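import Summits.AnomalousDissipation.AnomalousDissipation.Theorems.EnsembleRigidityGPTameDefectFloorParityForm2
import HarnessLib

/-!
# Tools B for stub `stub_gpParityForm3` of line `Sketch` (crux stmt-AnomalousDissipation-17938, `EnsembleRigidity.GPTameDefectFloor`) — the analytic layer of the `7/100` enstrophy certificate, for abstract slot weights

The `7/100` certificate `∫ (v ⊗ v) : ∇f_GP ≥ -(7/100) ‖∇v‖²` (file `…ParityForm3.lean`) refines the
`1/12` certificate of `…ParityForm2.lean` in one structural point: on the Fourier side
`I(u) = 2π Σⱼ Σₖ Re(conj ûⱼ(k - eⱼ) ûⱼ₊₁(k))`, and the terms touching a *vanishing* coefficient slot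
(`û(0) = 0` by the mean-zero condition, `ûᵢ(±eᵢ) = 0` by the divergence-free constraint
`k · û(k) = 0`) are *dropped* instead of bounded, so the AM–GM weights of such an edge may be `0`.
This file is the analysis for an abstract pair of slot weights `α, β : ℤ³ × Fin 3 → [0, C]`
(`α(p, m)`: weight on `ûₘ(p)` against its partner `ûₘ₊₁(p + eₘ)`; `β(p, m)`: weight on `ûₘ₊₁(p)`
against `ûₘ(p - eₘ)`), subject to: `α(k - eⱼ, j) β(k, j+1) ≥ 1` unless one of the two slots of the
edge is supported on a single axis (where the coefficient vanishes), a pointwise budget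
`Σₘ (α(p,m)|cₘ|² + β(p,m)|cₘ₊₁|²) ≤ K |p|² ‖c‖²` off the shells `0`, `2`, and the symmetrised budget
on `|p|² = 2` for transversal `c ⊥ p`. Conclusion (`form3_pairing_ge_enstrophy`):
`∫ ⟪∇f_GP u, u⟫ ≥ -(K/(4π)) ‖∇u‖²` for `u ∈ L²` with `û(0) = 0`, `k · û(k) = 0`, `‖∇u‖² < ∞`.
The lattice bookkeeping producing such weights with `K = 4π · 7/100` is `…ParityForm3ToolsA.lean`.
References: FMRT 2001, Ch. IV (the form `b`); Constantin–Foias 1988, Ch. 4 (4.33);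
Grafakos 2014, Prop. 3.2.7 (3) (Parseval on `Tⁿ`).
-/

-- `Summit.<Summit>.<Problem>` is the tree's mandated summit-side namespace (CONVENTIONS §2); single-conjunct summit, duplicate deliberate.
set_option linter.dupNamespace false

noncomputable section

namespace Summit.AnomalousDissipation.AnomalousDissipation.Theorems.EnsembleRigidity.GPTameDefectFloor

open MeasureTheory Filter Topology UnitAddTorus
open scoped InnerProductSpace RealInnerProductSpace ENNReal NNReal
open Literature.Analysis.FunctionSpaces Literature.Analysis.FluidPDE
open Summit.AnomalousDissipation.AnomalousDissipation.Theorems.EnsembleRigidity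

/-- Local notation: real vector fields on `T³`. -/
local notation "Vec3" => (UnitAddTorus (Fin 3)) → (EuclideanSpace ℝ (Fin 3))
/-- Local notation: `L²(T³; ℝ³)`. -/
local notation "L2" => (Lp (EuclideanSpace ℝ (Fin 3)) 2 (volume : Measure (UnitAddTorus (Fin 3))))
/-- Local notation: the energy space `H`. -/
local notation "H3" => (Torus.energySpace (Fin 3))

/-! ## Weighted AM–GM with dropped terms, and the one-shift Parseval bound -/

/-- Weighted AM–GM with dropped terms: for complex `a`, `b` and weights `p, q ≥ 0` such that
`a = 0`, or `b = 0`, or `p q ≥ 1`: `Re(conj(a) b) ≥ -(p |a|² + q |b|²)/2`. [folklore] -/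
theorem form3_re_conj_mul_ge (a b : ℂ) {p q : ℝ} (hp : 0 ≤ p) (hq : 0 ≤ q)
    (h : a = 0 ∨ b = 0 ∨ 1 ≤ p * q) :
    -((p * ‖a‖ ^ 2 + q * ‖b‖ ^ 2) / 2) ≤ (starRingEnd ℂ a * b).re := by
  rcases h with h | h | h
  · subst h
    simp only [map_zero, zero_mul, Complex.zero_re, norm_zero]
    nlinarith [mul_nonneg hq (sq_nonneg ‖b‖)]
  · subst h
    simp only [mul_zero, Complex.zero_re, norm_zero]
    nlinarith [mul_nonneg hp (sq_nonneg ‖a‖)]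
  · exact form2_re_conj_mul_ge a b hp h

/-- **One-shift Parseval with slot weights and dropped terms.** For weights `wa, wb ≥ 0` on `ℤ³`
such that for every `k` either `ĝ(k - eⱼ) = 0`, or `ĥ(k) = 0`, or `wa(k - eⱼ) wb(k) ≥ 1`, and real
`g, h ∈ L²(T³)` with `Σ_p wa(p)|ĝ(p)|² = S_g`, `Σₖ wb(k)|ĥ(k)|² = S_h`:
`∫ cos(2πxⱼ) g h ≥ -(S_g + S_h)/2`. Indeed `∫ cos(2πxⱼ) g h = Σₖ Re(conj ĝ(k - eⱼ) ĥ(k))`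
(polarised Parseval for `(eⱼ g, h)`, `𝓕(eⱼ g)(k) = ĝ(k - eⱼ)`) and termwise `form3_re_conj_mul_ge`.
[folklore] -/
theorem form3_integral_cos_mul_mul_ge (wa wb : (Fin 3 → ℤ) → ℝ) (ha : ∀ p, 0 ≤ wa p)
    (hb : ∀ p, 0 ≤ wb p) {g h : UnitAddTorus (Fin 3) → ℝ} (hg : MemLp g 2 volume)
    (hh : MemLp h 2 volume) (j : Fin 3)
    (hab : ∀ k : Fin 3 → ℤ, mFourierCoeff (fun x => (g x : ℂ)) (k - Pi.single j 1) = 0 ∨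
      mFourierCoeff (fun x => (h x : ℂ)) k = 0 ∨ 1 ≤ wa (k - Pi.single j 1) * wb k)
    {Sg Sh : ℝ} (hSg : HasSum (fun p => wa p * ‖mFourierCoeff (fun x => (g x : ℂ)) p‖ ^ 2) Sg)
    (hSh : HasSum (fun k => wb k * ‖mFourierCoeff (fun x => (h x : ℂ)) k‖ ^ 2) Sh) :
    -((Sg + Sh) / 2) ≤ ∫ x, (mFourier (Pi.single j (1 : ℤ)) x).re * (g x * h x) := by
  have hGm : MemLp (fun x => (g x : ℂ)) 2 volume := Complex.ofRealCLM.comp_memLp' hg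
  have hHm : MemLp (fun x => (h x : ℂ)) 2 volume := Complex.ofRealCLM.comp_memLp' hh
  -- the modulated function `eⱼ • g`
  have hMm : MemLp (fun x => mFourier (Pi.single j (1 : ℤ)) x • (g x : ℂ)) 2 volume := by
    refine hGm.of_le ((mFourier _).continuous.aestronglyMeasurable.smul hGm.1)
      (ae_of_all _ fun x => ?_)
    rw [norm_smul]
    calc ‖mFourier (Pi.single j (1 : ℤ)) x‖ * ‖(g x : ℂ)‖ ≤ 1 * ‖(g x : ℂ)‖ :=
          mul_le_mul_of_nonneg_right
            (((mFourier _).norm_coe_le_norm x).trans_eq mFourier_norm) (norm_nonneg _)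
      _ = ‖(g x : ℂ)‖ := one_mul _
  -- polarised Parseval for `(eⱼ • g, h)` with the shifted coefficients, real parts
  have hP := Torus.hasSum_conj_mul_mFourierCoeff hMm hHm
  simp only [Torus.mFourierCoeff_mFourier_smul] at hP
  have hR := Complex.hasSum_re hP
  -- the integral is the real part of `∫ conj(eⱼ g) h`
  have hptw : ∀ x, starRingEnd ℂ (mFourier (Pi.single j (1 : ℤ)) x • (g x : ℂ)) * (h x : ℂ) =
      mFourier (-Pi.single j (1 : ℤ)) x * ((g * h) x : ℂ) := fun x => by
    simp only [mFourier_neg, smul_eq_mul, map_mul, Complex.conj_ofReal, Pi.mul_apply,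
      Complex.ofReal_mul]
    ring
  have hint : Integrable (fun x => mFourier (-Pi.single j (1 : ℤ)) x * ((g * h) x : ℂ)) volume :=
    (hg.integrable_mul hh).ofReal.bdd_mul (c := 1) (mFourier _).continuous.aestronglyMeasurable
      (ae_of_all _ fun x => ((mFourier _).norm_coe_le_norm x).trans_eq mFourier_norm)
  have hval : (∫ x, starRingEnd ℂ (mFourier (Pi.single j (1 : ℤ)) x • (g x : ℂ)) * (h x : ℂ)).re =
      ∫ x, (mFourier (Pi.single j (1 : ℤ)) x).re * (g x * h x) := by
    simp_rw [hptw]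
    have h1 := integral_re hint
    simp only [RCLike.re_to_complex] at h1
    rw [← h1]
    refine integral_congr_ae (ae_of_all _ fun x => ?_)
    simp [mFourier_neg, Complex.mul_re]
  rw [hval] at hR
  -- the lower series: re-index the `g`-sum by the shift `k ↦ k - eⱼ`
  have hSg' : HasSum (fun k : Fin 3 → ℤ => wa (k - Pi.single j 1) *
      ‖mFourierCoeff (fun x => (g x : ℂ)) (k - Pi.single j 1)‖ ^ 2) Sg := by
    have h0 := (Equiv.subRight (Pi.single j (1 : ℤ))).hasSum_iff.2 hSg
    simpa only [Function.comp_def, Equiv.subRight_apply] using h0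
  have hF := ((hSg'.add hSh).div_const 2).neg
  exact hasSum_le (fun k => form3_re_conj_mul_ge _ _ (ha _) (hb _) (hab k)) hF hR

/-! ## The pairing against `f_GP`: the charge series -/

/-- **Step A (slot weights).** For `u ∈ L²(T³; ℝ³)` and slot weights `α, β ≥ 0` such that along
every edge `(k - eⱼ, j) → (k, j+1)` either an end coefficient vanishes or `α(k - eⱼ, j) β(k, j) ≥ 1`,
with `Aⱼ = Σ_p α(p, j)|ûⱼ(p)|²` and `Bⱼ = Σ_p β(p, j)|ûⱼ₊₁(p)|²`:
`∫ ⟪∇f_GP u, u⟫ ≥ -π Σⱼ (Aⱼ + Bⱼ)`. [folklore] -/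
theorem form3_pairing_ge (α β : (Fin 3 → ℤ) → Fin 3 → ℝ) (hα : ∀ p m, 0 ≤ α p m)
    (hβ : ∀ p m, 0 ≤ β p m) {u : Vec3} (hu : MemLp u 2 volume)
    (hedge : ∀ (k : Fin 3 → ℤ) (j : Fin 3),
      mFourierCoeff (fun x => (u x j : ℂ)) (k - Pi.single j 1) = 0 ∨
      mFourierCoeff (fun x => (u x (j + 1) : ℂ)) k = 0 ∨ 1 ≤ α (k - Pi.single j 1) j * β k j)
    {A B : Fin 3 → ℝ}
    (hA : ∀ j, HasSum (fun p => α p j * ‖mFourierCoeff (fun x => (u x j : ℂ)) p‖ ^ 2) (A j))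
    (hB : ∀ j, HasSum (fun p => β p j * ‖mFourierCoeff (fun x => (u x (j + 1) : ℂ)) p‖ ^ 2) (B j)) :
    -(Real.pi * ∑ j, (A j + B j)) ≤ ∫ x, ⟪Torus.fderiv gpForce x (u x), u x⟫_ℝ := by
  have huc : ∀ i : Fin 3, MemLp (fun x => u x i) 2 volume := fun i => hu.eval_piLp i
  have key : ∀ j : Fin 3, -((A j + B j) / 2) ≤
      ∫ x, (mFourier (Pi.single j (1 : ℤ)) x).re * (u x j * u x (j + 1)) := fun j =>
    form3_integral_cos_mul_mul_ge (fun p => α p j) (fun p => β p j) (fun p => hα p j)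
      (fun p => hβ p j) (huc j) (huc (j + 1)) j (hedge · j) (hA j) (hB j)
  have h20 := key 2
  have h01 := key 0
  have h12 := key 1
  simp only [zero_add, form2_fin_succ] at h20 h01 h12
  have i20 := parity_integrable_cos_mul_mul (huc 2) (huc 0) (Pi.single (2 : Fin 3) (1 : ℤ))
  have i01 := parity_integrable_cos_mul_mul (huc 0) (huc 1) (Pi.single (0 : Fin 3) (1 : ℤ))
  have i12 := parity_integrable_cos_mul_mul (huc 1) (huc 2) (Pi.single (1 : Fin 3) (1 : ℤ))
  have i2001 : Integrable (fun x =>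
      (mFourier (Pi.single (2 : Fin 3) (1 : ℤ)) x).re * (u x 2 * u x 0) +
        (mFourier (Pi.single (0 : Fin 3) (1 : ℤ)) x).re * (u x 0 * u x 1)) volume := i20.add i01
  simp_rw [parity_inner_fderiv_gpForce]
  rw [integral_const_mul, integral_add i2001 i12, integral_add i20 i01]
  simp only [Fin.sum_univ_three]
  have hπ : 0 < Real.pi := Real.pi_pos
  nlinarith

/-! ## Summability, the symmetrised budget, vanishing slots -/

/-- Summability of a boundedly weighted component series `Σ_p w(p) |ûᵢ(p)|²`, `0 ≤ w ≤ C`, from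
Parseval. [folklore] -/
theorem form3_summable (w : (Fin 3 → ℤ) → ℝ) {C : ℝ} (hw0 : ∀ p, 0 ≤ w p) (hwC : ∀ p, w p ≤ C)
    {u : Vec3} (hu : MemLp u 2 volume) (i : Fin 3) :
    Summable (fun p => w p * ‖mFourierCoeff (fun x => (u x i : ℂ)) p‖ ^ 2) := by
  have hP := (Torus.hasSum_sq_norm_mFourierCoeff (Torus.memLp_ofReal_apply hu i)).summable
  exact Summable.of_nonneg_of_le (fun p => mul_nonneg (hw0 _) (sq_nonneg _))
    (fun p => mul_le_mul_of_nonneg_right (hwC p) (sq_nonneg _)) (hP.mul_left C)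

/-- **The summed budget** (constant `K`). For a coefficient family `c : ℤ³ → ℂ³` with `c(0) = 0`,
real (`|c_m(-p)| = |c_m(p)|`) and transversal (`p · c(p) = 0`), slot weights `α, β` with the
pointwise budget off the shells `0, 2` and the symmetrised budget on `|p|² = 2`, and convergent
series `G = Σ_p |p|² ‖c(p)‖²`, `S = Σ_p Σ_m (α(p,m)|c_m(p)|² + β(p,m)|c_{m+1}(p)|²)`: `S ≤ K G`.
[folklore] -/
theorem form3_budget (α β : (Fin 3 → ℤ) → Fin 3 → ℝ) (K : ℝ)
    (hW4 : ∀ p : Fin 3 → ℤ, p ≠ 0 → Torus.freqNormSq p ≠ 2 → ∀ c : Fin 3 → ℂ,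
      ∑ m, (α p m * ‖c m‖ ^ 2 + β p m * ‖c (m + 1)‖ ^ 2) ≤
        K * Torus.freqNormSq p * ∑ m, ‖c m‖ ^ 2)
    (hW5 : ∀ p : Fin 3 → ℤ, Torus.freqNormSq p = 2 → ∀ c : Fin 3 → ℂ, ∑ i, (p i : ℂ) * c i = 0 →
      ∑ m, (α p m * ‖c m‖ ^ 2 + β p m * ‖c (m + 1)‖ ^ 2) +
        ∑ m, (α (-p) m * ‖c m‖ ^ 2 + β (-p) m * ‖c (m + 1)‖ ^ 2) ≤ 2 * (K * 2 * ∑ m, ‖c m‖ ^ 2))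
    (c : (Fin 3 → ℤ) → Fin 3 → ℂ) (hc0 : ∀ m, c 0 m = 0) (hneg : ∀ p m, ‖c (-p) m‖ = ‖c p m‖)
    (hdiv : ∀ p : Fin 3 → ℤ, ∑ i, (p i : ℂ) * c p i = 0) {G S : ℝ}
    (hG : HasSum (fun p => Torus.freqNormSq p * ∑ m, ‖c p m‖ ^ 2) G)
    (hS : HasSum (fun p : Fin 3 → ℤ => ∑ m, (α p m * ‖c p m‖ ^ 2 + β p m * ‖c p (m + 1)‖ ^ 2)) S) :
    S ≤ K * G := by
  have hD := (hG.mul_left K).sub hS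
  have hDn : HasSum (fun p : Fin 3 → ℤ => K * (Torus.freqNormSq (-p) * ∑ m, ‖c (-p) m‖ ^ 2) -
      ∑ m, (α (-p) m * ‖c (-p) m‖ ^ 2 + β (-p) m * ‖c (-p) (m + 1)‖ ^ 2)) (K * G - S) := by
    have h0 := (Equiv.neg (Fin 3 → ℤ)).hasSum_iff.2 hD
    simpa only [Function.comp_def, Equiv.neg_apply] using h0
  have key : ∀ p : Fin 3 → ℤ, 0 ≤ K * (Torus.freqNormSq p * ∑ m, ‖c p m‖ ^ 2) -
      ∑ m, (α p m * ‖c p m‖ ^ 2 + β p m * ‖c p (m + 1)‖ ^ 2) +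
      (K * (Torus.freqNormSq (-p) * ∑ m, ‖c (-p) m‖ ^ 2) -
      ∑ m, (α (-p) m * ‖c (-p) m‖ ^ 2 + β (-p) m * ‖c (-p) (m + 1)‖ ^ 2)) := by
    intro p
    by_cases hp0 : p = 0
    · subst hp0
      simp [hc0]
    have hnn : ∀ m, ‖c (-p) m‖ ^ 2 = ‖c p m‖ ^ 2 := fun m => by rw [hneg]
    have hNn : Torus.freqNormSq (-p) = Torus.freqNormSq p := by simp [Torus.freqNormSq]
    simp only [hnn, hNn]
    by_cases hp2 : Torus.freqNormSq p = 2
    · have h5 := hW5 p hp2 (c p) (hdiv p)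
      rw [hp2]
      linarith
    · have h4 := hW4 p hp0 hp2 (c p)
      have h4' := hW4 (-p) (neg_ne_zero.2 hp0) (by rwa [hNn]) (c p)
      rw [hNn] at h4'
      linarith
  have h := (hD.add hDn).nonneg key
  linarith

/-- Vanishing slots: if `û(0) = 0` and `k · û(k) = 0` for all `k`, then `ûⱼ(q) = 0` whenever `q` is
supported on the axis `j` (`q = t eⱼ`; for `t ≠ 0` this is the longitudinal coefficient). [folklore] -/
theorem form3_coeff_zero {u : Vec3} (hu : MemLp u 2 volume)
    (hU0 : mFourierCoeff (EuclideanSpace.complexify ∘ u) 0 = 0)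
    (hdiv : ∀ k : Fin 3 → ℤ,
      ∑ j, (k j : ℂ) * mFourierCoeff (EuclideanSpace.complexify ∘ u) k j = 0)
    (q : Fin 3 → ℤ) (j : Fin 3) (hq : ∀ i, i ≠ j → q i = 0) :
    mFourierCoeff (fun x => (u x j : ℂ)) q = 0 := by
  have hui : Integrable u volume := hu.integrable one_le_two
  rw [← Torus.mFourierCoeff_complexify_apply hui]
  by_cases hqj : q j = 0
  · have hq0 : q = 0 := funext fun i => by
      by_cases hi : i = j
      · rw [hi, hqj]; rfl
      · exact hq i hi
    rw [hq0, hU0]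
    rfl
  · have h := hdiv q
    rw [Finset.sum_eq_single j (fun i _ hi => by rw [hq i hi, Int.cast_zero, zero_mul])
      (fun hj => absurd (Finset.mem_univ j) hj)] at h
    rcases mul_eq_zero.1 h with h | h
    · exact absurd (by exact_mod_cast h) hqj
    · exact h

/-! ## Assembly for abstract slot weights -/

/-- **The `K/(4π)` bound for abstract slot weights.** Let `α, β : ℤ³ × Fin 3 → [0, C]` satisfy:
along every edge `(k - eⱼ, j) → (k, j+1)` either one of the two slots is supported on its own axis
or `α(k - eⱼ, j) β(k, j) ≥ 1`; the pointwise budget with constant `K` off the shells `0, 2`; the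
symmetrised shell-`2` budget for transversal `c`. Then for `u ∈ L²(T³; ℝ³)` with `û(0) = 0`,
`k · û(k) = 0` and `‖∇u‖² < ∞`: `∫ ⟪∇f_GP u, u⟫ ≥ -(K/(4π)) ‖∇u‖²`. [folklore] -/
theorem form3_pairing_ge_enstrophy (α β : (Fin 3 → ℤ) → Fin 3 → ℝ) (K C : ℝ)
    (hα : ∀ p m, 0 ≤ α p m) (hβ : ∀ p m, 0 ≤ β p m) (hαC : ∀ p m, α p m ≤ C)
    (hβC : ∀ p m, β p m ≤ C)
    (hedge : ∀ (k : Fin 3 → ℤ) (j : Fin 3), (∀ i, i ≠ j → (k - Pi.single j 1 : Fin 3 → ℤ) i = 0) ∨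
      (∀ i, i ≠ j + 1 → k i = 0) ∨ 1 ≤ α (k - Pi.single j 1) j * β k j)
    (hW4 : ∀ p : Fin 3 → ℤ, p ≠ 0 → Torus.freqNormSq p ≠ 2 → ∀ c : Fin 3 → ℂ,
      ∑ m, (α p m * ‖c m‖ ^ 2 + β p m * ‖c (m + 1)‖ ^ 2) ≤
        K * Torus.freqNormSq p * ∑ m, ‖c m‖ ^ 2)
    (hW5 : ∀ p : Fin 3 → ℤ, Torus.freqNormSq p = 2 → ∀ c : Fin 3 → ℂ, ∑ i, (p i : ℂ) * c i = 0 →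
      ∑ m, (α p m * ‖c m‖ ^ 2 + β p m * ‖c (m + 1)‖ ^ 2) +
        ∑ m, (α (-p) m * ‖c m‖ ^ 2 + β (-p) m * ‖c (m + 1)‖ ^ 2) ≤ 2 * (K * 2 * ∑ m, ‖c m‖ ^ 2))
    {u : Vec3} (hu : MemLp u 2 volume)
    (hU0 : mFourierCoeff (EuclideanSpace.complexify ∘ u) 0 = 0)
    (hdiv : ∀ k : Fin 3 → ℤ,
      ∑ j, (k j : ℂ) * mFourierCoeff (EuclideanSpace.complexify ∘ u) k j = 0)
    (hfin : Torus.eGradNormSq u ≠ ⊤) :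
    -(K / (4 * Real.pi) * (Torus.eGradNormSq u).toReal) ≤
      ∫ x, ⟪Torus.fderiv gpForce x (u x), u x⟫_ℝ := by
  have hui : Integrable u volume := hu.integrable one_le_two
  have hπ : 0 < Real.pi := Real.pi_pos
  -- the charge series
  have hA' : ∀ j : Fin 3, ∃ a : ℝ, HasSum (fun p => α p j *
      ‖mFourierCoeff (fun x => (u x j : ℂ)) p‖ ^ 2) a := fun j =>
    ⟨_, (form3_summable (fun p => α p j) (fun p => hα p j) (fun p => hαC p j) hu j).hasSum⟩
  have hB' : ∀ j : Fin 3, ∃ b : ℝ, HasSum (fun p => β p j *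
      ‖mFourierCoeff (fun x => (u x (j + 1) : ℂ)) p‖ ^ 2) b := fun j =>
    ⟨_, (form3_summable (fun p => β p j) (fun p => hβ p j) (fun p => hβC p j) hu (j + 1)).hasSum⟩
  choose A hA using hA'
  choose B hB using hB'
  have hz := form3_coeff_zero hu hU0 hdiv
  have hedge' : ∀ (k : Fin 3 → ℤ) (j : Fin 3),
      mFourierCoeff (fun x => (u x j : ℂ)) (k - Pi.single j 1) = 0 ∨
      mFourierCoeff (fun x => (u x (j + 1) : ℂ)) k = 0 ∨ 1 ≤ α (k - Pi.single j 1) j * β k j :=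
    fun k j => (hedge k j).imp (hz _ _) (Or.imp_left (hz _ _))
  have h1 := form3_pairing_ge α β hα hβ hu hedge' hA hB
  -- the budget
  have hcU : ∀ p i, mFourierCoeff (EuclideanSpace.complexify ∘ u) p i =
      mFourierCoeff (fun x => (u x i : ℂ)) p := fun p i => Torus.mFourierCoeff_complexify_apply hui p i
  have hnormU : ∀ p, ‖mFourierCoeff (EuclideanSpace.complexify ∘ u) p‖ ^ 2 =
      ∑ m, ‖mFourierCoeff (fun x => (u x m : ℂ)) p‖ ^ 2 := fun p => by
    rw [EuclideanSpace.norm_sq_eq]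
    exact Finset.sum_congr rfl fun m _ => by rw [hcU]
  have hG : HasSum (fun p => Torus.freqNormSq p * ∑ m, ‖mFourierCoeff (fun x => (u x m : ℂ)) p‖ ^ 2)
      ((Torus.eGradNormSq u).toReal / (4 * Real.pi ^ 2)) := by
    have h := form2_enstrophy_hasSum hfin
    simp only [hnormU] at h
    exact h
  have hS := hasSum_sum fun j (_ : j ∈ Finset.univ) => (hA j).add (hB j)
  have hc0 : ∀ m, mFourierCoeff (fun x => (u x m : ℂ)) 0 = 0 := fun m => by
    rw [← hcU, hU0]
    rfl
  have hneg : ∀ (p : Fin 3 → ℤ) (m : Fin 3), ‖mFourierCoeff (fun x => (u x m : ℂ)) (-p)‖ =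
      ‖mFourierCoeff (fun x => (u x m : ℂ)) p‖ := fun p m => by
    rw [Torus.mFourierCoeff_ofReal_comp, Complex.norm_conj]
  have hdiv' : ∀ p : Fin 3 → ℤ, ∑ i, (p i : ℂ) * mFourierCoeff (fun x => (u x i : ℂ)) p = 0 :=
    fun p => by simpa only [hcU] using hdiv p
  have h2 := form3_budget α β K hW4 hW5 (fun p i => mFourierCoeff (fun x => (u x i : ℂ)) p) hc0 hneg
    hdiv' hG hS
  have h3 : Real.pi * ∑ j, (A j + B j) ≤ K / (4 * Real.pi) * (Torus.eGradNormSq u).toReal :=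
    calc Real.pi * ∑ j, (A j + B j)
        ≤ Real.pi * (K * ((Torus.eGradNormSq u).toReal / (4 * Real.pi ^ 2))) :=
          mul_le_mul_of_nonneg_left h2 hπ.le
      _ = K / (4 * Real.pi) * (Torus.eGradNormSq u).toReal := by
          field_simp
  linarith

/-- **Tools stub `stub_gpParityForm3ToolsB`**: the analytic layer of the `7/100` certificate for
abstract slot weights (`form3_pairing_ge_enstrophy`): slot weights `α, β ∈ [0, C]` with the
dropped-edge product condition, the pointwise budget with constant `K` off the shells `0, 2` and
the symmetrised shell-`2` budget give `∫ ⟪∇f_GP u, u⟫ ≥ -(K/(4π)) ‖∇u‖²` for `u ∈ L²` with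
`û(0) = 0`, `k · û(k) = 0`, `‖∇u‖² < ∞`. [folklore] -/
theorem stub_gpParityForm3ToolsB : ∀ (α β : (Fin 3 → ℤ) → Fin 3 → ℝ) (K C : ℝ), (∀ p m, 0 ≤ α p m) → (∀ p m, 0 ≤ β p m) → (∀ p m, α p m ≤ C) → (∀ p m, β p m ≤ C) → (∀ (k : Fin 3 → ℤ) (j : Fin 3), (∀ i, i ≠ j → (k - Pi.single j 1 : Fin 3 → ℤ) i = 0) ∨ (∀ i, i ≠ j + 1 → k i = 0) ∨ 1 ≤ α (k - Pi.single j 1) j * β k j) → (∀ p : Fin 3 → ℤ, p ≠ 0 → Torus.freqNormSq p ≠ 2 → ∀ c : Fin 3 → ℂ, ∑ m, (α p m * ‖c m‖ ^ 2 + β p m * ‖c (m + 1)‖ ^ 2) ≤ K * Torus.freqNormSq p * ∑ m, ‖c m‖ ^ 2) → (∀ p : Fin 3 → ℤ, Torus.freqNormSq p = 2 → ∀ c : Fin 3 → ℂ, ∑ i, (p i : ℂ) * c i = 0 → ∑ m, (α p m * ‖c m‖ ^ 2 + β p m * ‖c (m + 1)‖ ^ 2) + ∑ m, (α (-p) m *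 ‖c m‖ ^ 2 + β (-p) m * ‖c (m + 1)‖ ^ 2) ≤ 2 * (K * 2 * ∑ m, ‖c m‖ ^ 2)) → ∀ u : Vec3, MemLp u 2 volume → mFourierCoeff (EuclideanSpace.complexify ∘ u) 0 = 0 → (∀ k : Fin 3 → ℤ, ∑ j, (k j : ℂ) * mFourierCoeff (EuclideanSpace.complexify ∘ u) k j = 0) → Torus.eGradNormSq u ≠ ⊤ → -(K / (4 * Real.pi) * (Torus.eGradNormSq u).toReal) ≤ ∫ x, ⟪Torus.fderiv gpForce x (u x), u x⟫_ℝ :=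
  fun α β K C hα hβ hαC hβC hedge hW4 hW5 _ hu hU0 hdiv hfin =>
    form3_pairing_ge_enstrophy α β K C hα hβ hαC hβC hedge hW4 hW5 hu hU0 hdiv hfin

end Summit.AnomalousDissipation.AnomalousDissipation.Theorems.EnsembleRigidity.GPTameDefectFloor

end
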